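import Summits.Ventures.Crystal3D.Theorems.StickyWulffConstantCoaxialWallLawStdCases8Prefix
import Summits.Ventures.Crystal3D.Theorems.StickyWulffConstantCoaxialWallLawChainPrefix
import HarnessLib

/-!
# CLASS COLLAPSE ON THE EIGHT STANDARD DOZENS: the standard classes of a deep frame's joint plate systems are classes of the joint
# systems of ONE standard frame — same frame, same direction (crux `CoaxialWallLaw`, stmt-Ventures-19481, line `WallLedgerF`)

HONEST FRAMING. Venture `Summits/Ventures/Crystal3D` (cell `crystal3d-full`), helper `--supports` the crux `CoaxialWallLaw` of
`route-Ventures-StickyWulffConstant` (REGISTERED line `WallLedgerF`, skeleton 'CoaxialWallLawCertificates' v3, registered stub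
`stub_moduleCapture : TailResidue.ModuleCapture`).  Rung credit only; F-C1 not moved; census-free, no kissing facts.
Items (L2′)+(L3′) of HOME/wall-19481-p2/MODULE-CAPTURE-PLAN-g10.md §6–§7 («generalized class collapse»), the algebraic heart of the
DEEP case of `ModuleCapture`: the two joint plate systems of a payer window are `basalSystem L̃` and `basalSystem (H ≫ L̃)` (`H` the
half-turn about `e₃`), and only classes whose frame is STANDARD (`StdFrame`: slot dozen among the eight dozens `D₊, D₋, R_cD₊, R_{c+3}D₋`)
can fire on the exact part (`…ReadingDirectionsLattice.stdFrame_of_exact_reader`).  This file proves that ALL standard classes of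
the two systems of an ARBITRARY frame `L̃` are classes — with the SAME frame and the SAME direction — of the two systems of ONE
standard frame `L₀` (the frame of a minimal-length standard class):
* `isChain_append_of_minimal` — JUNCTION LEMMA: for a minimal standard class `κ₀` of root `r₀` and the prefix-closed connecting
  chain `P` of `…StdCases8Prefix.std_cases8_fw_prefix`, the word `P ++ κ₀` is REDUCED (a cancelling time-first letter of `P` would
  make `κ₀.tail` a shorter standard class);
* **`adm_transfer_of_minimal`** — with `κ₀` a standard class of `basalSystem L̃` of minimal length among the standard classes of
  that system and `F := Fw κ₀`: every standard class `(G, d)` of `basalSystem L̃` IS a class of `basalSystem F` (reduced-word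
  rigidity `…ReducedWordRigidity.reduced_forall₂_of_foldl_image_eq` makes `κ = Q ++ κ₀'` with `κ₀' ≃ κ₀` letterwise up to sign, and
  `…ChainPrefix.adm_transfer_of_append` moves the base), and a standard class of the companion `basalSystem (H ≫ L̃)` forces
  `κ₀ = []` (its dozen reads the word `κ ++ [e₃]`, `…ClassCollapse.image_fw_halfTurn`, whose last letter `e₃` would have to be
  `±` the time-first letter of `κ₀`, a chain letter of a basal root — `wfChain_letter_ne_axis`), so it is a class of
  `basalSystem (H ≫ F)` verbatim;
* **`exists_stdFrame_adm_transfer`** — for EVERY frame `L̃` there is a STANDARD `L₀` such that every standard admissible class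
  `(G, d)` of `basalSystem L̃` or `basalSystem (H ≫ L̃)` is an admissible class of `basalSystem L₀` or `basalSystem (H ≫ L₀)`
  (minimal standard class of the first system; else of the second, through `H ≫ H ≫ L̃ = L̃`; else vacuous).
Numerical cross-check of record: HOME/wall-19481-p2/g10-calc/gcc_rule.py (400/400 deep frames: the minimal firing frame captures).
WHAT THIS IS NOT: not `ModuleCapture` (the window bookkeeping is `…TailResidueModuleCapture`), not the stub; F-C1 not moved.
-/

noncomputable section

namespace Summit.Ventures.Crystal3D.Theorems

open Summit.Ventures.Crystal3D Finset TailResidue ReflWord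
open scoped InnerProductSpace

section Collapse8

/-! ### The junction lemma -/

/-- **JUNCTION LEMMA.**  If `κ₀` (a well-formed chain of `r₀`) has minimal length among the standard classes of root `r₀`, and `P`
is a chain of unit model menu normals all of whose time-prefixes `P.drop n ++ κ₀` have standard frames, then `P ++ κ₀` is a
reduced chain: the time-first letter of `P` does not cancel the head of `κ₀`. -/
theorem isChain_append_of_minimal (S : PlateSystem) {r₀ : EuclideanSpace ℝ (Fin 3)} {κ₀ : List (EuclideanSpace ℝ (Fin 3))}
    (hκ₀ : WFChain r₀ κ₀)
    (hmin : ∀ κ : List (EuclideanSpace ℝ (Fin 3)), WFChain r₀ κ → κ.length < κ₀.length → ¬ StdFrame (S.Fw κ))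
    {P : List (EuclideanSpace ℝ (Fin 3))}
    (hletP : ∀ p ∈ P, ‖p‖ = 1 ∧
      ∀ w ∈ fccSlots, ⟪w, p⟫_ℝ = 0 ∨ ⟪w, p⟫_ℝ = Real.sqrt (2 / 3) ∨ ⟪w, p⟫_ℝ = -Real.sqrt (2 / 3))
    (hchP : List.IsChain (fun μ μ' : EuclideanSpace ℝ (Fin 3) => ⟪μ, μ'⟫_ℝ = 1 / 3 ∨ ⟪μ, μ'⟫_ℝ = -1 / 3) P)
    (hpre : ∀ n : ℕ, StdFrame (S.Fw (P.drop n ++ κ₀))) :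
    List.IsChain (fun μ μ' : EuclideanSpace ℝ (Fin 3) => ⟪μ, μ'⟫_ℝ = 1 / 3 ∨ ⟪μ, μ'⟫_ℝ = -1 / 3) (P ++ κ₀) := by
  obtain ⟨hlet₀, hch₀⟩ := wfChain_letters hκ₀
  refine List.IsChain.append hchP hch₀ fun x hx y hy => ?_
  obtain ⟨P', rfl⟩ : ∃ P', P = P' ++ [x] := List.getLast?_eq_some_iff.1 hx
  obtain ⟨κ₀', rfl⟩ : ∃ κ₀', κ₀ = y :: κ₀' := List.head?_eq_some_iff.1 hy
  obtain ⟨hx1, hxm⟩ := hletP x (by simp)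
  obtain ⟨hy1, hym⟩ := hlet₀ y (by simp)
  have hmx : ∀ w ∈ fccSlots,
      ⟪(LinearIsometryEquiv.refl ℝ (EuclideanSpace ℝ (Fin 3))) w, x⟫_ℝ = 0 ∨
      ⟪(LinearIsometryEquiv.refl ℝ (EuclideanSpace ℝ (Fin 3))) w, x⟫_ℝ = Real.sqrt (2 / 3) ∨
      ⟪(LinearIsometryEquiv.refl ℝ (EuclideanSpace ℝ (Fin 3))) w, x⟫_ℝ = -Real.sqrt (2 / 3) := by
    intro w hw; simpa using hxm w hw
  have hmy : ∀ w ∈ fccSlots,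
      ⟪(LinearIsometryEquiv.refl ℝ (EuclideanSpace ℝ (Fin 3))) w, y⟫_ℝ = 0 ∨
      ⟪(LinearIsometryEquiv.refl ℝ (EuclideanSpace ℝ (Fin 3))) w, y⟫_ℝ = Real.sqrt (2 / 3) ∨
      ⟪(LinearIsometryEquiv.refl ℝ (EuclideanSpace ℝ (Fin 3))) w, y⟫_ℝ = -Real.sqrt (2 / 3) := by
    intro w hw; simpa using hym w hw
  -- if `x = ±y`, the prefix `[x] ++ κ₀` has the frame of `κ₀'`, a SHORTER standard class of the same root
  have hdeg : ¬ (x = y ∨ x = -y) := by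
    intro hxy
    have hstd := hpre P'.length
    rw [List.drop_left, List.singleton_append, fw_cons_cons_of_sign S κ₀' hxy hy1] at hstd
    have hwf : WFChain r₀ κ₀' := ((PlateSystem.wfChain_cons r₀ y κ₀').1 hκ₀).1
    exact hmin κ₀' hwf (by simp) hstd
  rcases inner_menuNormals (LinearIsometryEquiv.refl ℝ _) hx1 hy1 hmx hmy with h | h | h | h
  · exact absurd (Or.inl ((inner_eq_one_iff_of_norm_eq_one (𝕜 := ℝ) hx1 hy1).1 h)) hdeg
  · have hyx := eq_neg_of_inner_eq_neg_one' hx1 hy1 h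
    exact absurd (Or.inr (by rw [hyx, neg_neg])) hdeg
  · exact Or.inl h
  · exact Or.inr h

/-! ### The transfer from a minimal standard class -/

/-- Letters of a concatenation. -/
theorem letters_append {P κ : List (EuclideanSpace ℝ (Fin 3))}
    (hP : ∀ p ∈ P, ‖p‖ = 1 ∧
      ∀ w ∈ fccSlots, ⟪w, p⟫_ℝ = 0 ∨ ⟪w, p⟫_ℝ = Real.sqrt (2 / 3) ∨ ⟪w, p⟫_ℝ = -Real.sqrt (2 / 3))
    (hκ : ∀ p ∈ κ, ‖p‖ = 1 ∧
      ∀ w ∈ fccSlots, ⟪w, p⟫_ℝ = 0 ∨ ⟪w, p⟫_ℝ = Real.sqrt (2 / 3) ∨ ⟪w, p⟫_ℝ = -Real.sqrt (2 / 3)) :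
    ∀ p ∈ P ++ κ, ‖p‖ = 1 ∧
      ∀ w ∈ fccSlots, ⟪w, p⟫_ℝ = 0 ∨ ⟪w, p⟫_ℝ = Real.sqrt (2 / 3) ∨ ⟪w, p⟫_ℝ = -Real.sqrt (2 / 3) := by
  intro p hp
  rcases List.mem_append.1 hp with hp | hp
  · exact hP p hp
  · exact hκ p hp

/-- A chain of a basal root followed (in time: preceded) by the basal letter `e₃` is a reduced chain of unit model menu normals. -/
theorem letters_chain_concat_axis {r : EuclideanSpace ℝ (Fin 3)} (hr2 : r 2 = 0) {κ : List (EuclideanSpace ℝ (Fin 3))}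
    (hκ : WFChain r κ) :
    (∀ μ ∈ κ ++ [EuclideanSpace.single (2 : Fin 3) (1 : ℝ)], ‖μ‖ = 1 ∧
      ∀ w ∈ fccSlots, ⟪w, μ⟫_ℝ = 0 ∨ ⟪w, μ⟫_ℝ = Real.sqrt (2 / 3) ∨ ⟪w, μ⟫_ℝ = -Real.sqrt (2 / 3)) ∧
    List.IsChain (fun μ μ' : EuclideanSpace ℝ (Fin 3) => ⟪μ, μ'⟫_ℝ = 1 / 3 ∨ ⟪μ, μ'⟫_ℝ = -1 / 3)
      (κ ++ [EuclideanSpace.single (2 : Fin 3) (1 : ℝ)]) := by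
  have he₃1 : ‖EuclideanSpace.single (2 : Fin 3) (1 : ℝ)‖ = 1 := by rw [PiLp.norm_single, norm_one]
  have he₃m : ∀ w ∈ fccSlots, ⟪w, EuclideanSpace.single (2 : Fin 3) (1 : ℝ)⟫_ℝ = 0 ∨
      ⟪w, EuclideanSpace.single (2 : Fin 3) (1 : ℝ)⟫_ℝ = Real.sqrt (2 / 3) ∨
      ⟪w, EuclideanSpace.single (2 : Fin 3) (1 : ℝ)⟫_ℝ = -Real.sqrt (2 / 3) := by
    intro w hw; rw [inner_single_two_one]; exact slot_apply_two_cases hw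
  obtain ⟨hlet, hch⟩ := wfChain_letters hκ
  refine ⟨letters_append hlet (fun μ hμ => by rw [List.mem_singleton.1 hμ]; exact ⟨he₃1, he₃m⟩), ?_⟩
  -- reversed, this is «prepend `e₃` to `κ.reverse`», and `e₃` is not `±` any letter of `κ`
  rw [← List.isChain_reverse, List.reverse_append, List.reverse_singleton, List.singleton_append]
  have hletr : ∀ μ ∈ κ.reverse, ‖μ‖ = 1 ∧
      ∀ w ∈ fccSlots, ⟪w, μ⟫_ℝ = 0 ∨ ⟪w, μ⟫_ℝ = Real.sqrt (2 / 3) ∨ ⟪w, μ⟫_ℝ = -Real.sqrt (2 / 3) :=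
    fun μ hμ => hlet μ (List.mem_reverse.1 hμ)
  have hchr : List.IsChain (fun μ μ' : EuclideanSpace ℝ (Fin 3) => ⟪μ, μ'⟫_ℝ = 1 / 3 ∨ ⟪μ, μ'⟫_ℝ = -1 / 3) κ.reverse := by
    rw [List.isChain_reverse]; exact hch.imp fun a b h => by rw [real_inner_comm]; exact h
  have key := isChain_cons_of_ne ⟨he₃1, he₃m⟩ hletr hchr fun μ hμ => by
    have hμκ : μ ∈ κ := List.mem_reverse.1 (List.mem_of_mem_head? hμ)
    obtain ⟨h1, h2⟩ := wfChain_letter_ne_axis hr2 hκ hμκ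
    refine ⟨fun h => h1 h.symm, fun h => h2 ?_⟩
    rw [h, neg_neg]
  exact key.imp fun a b h => by rw [real_inner_comm]; exact h

/-- **TRANSFER FROM A MINIMAL STANDARD CLASS.**  Let `κ₀` be a well-formed chain of a basal root `r₀` whose frame in `basalSystem L̃`
is standard, of minimal length among such (for the root `r₀`), and `F := Fw κ₀`.  Then every STANDARD admissible class `(G, d)` of
`basalSystem L̃` or of the companion `basalSystem (H ≫ L̃)` is an admissible class of `basalSystem F` or of `basalSystem (H ≫ F)` —
with the same frame `G` and the same direction `d`. -/
theorem adm_transfer_of_minimal (L' : EuclideanSpace ℝ (Fin 3) ≃ₗᵢ[ℝ] EuclideanSpace ℝ (Fin 3))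
    {r₀ : EuclideanSpace ℝ (Fin 3)} (hr₀ : r₀ ∈ basalHexagon) {κ₀ : List (EuclideanSpace ℝ (Fin 3))} (hκ₀ : WFChain r₀ κ₀)
    (hstd₀ : StdFrame ((basalSystem L').Fw κ₀))
    (hmin : ∀ κ : List (EuclideanSpace ℝ (Fin 3)), WFChain r₀ κ → κ.length < κ₀.length → ¬ StdFrame ((basalSystem L').Fw κ))
    {G : EuclideanSpace ℝ (Fin 3) ≃ₗᵢ[ℝ] EuclideanSpace ℝ (Fin 3)} {d : EuclideanSpace ℝ (Fin 3)}
    (hadm : (basalSystem L').Adm G d ∨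
      (basalSystem (((ℝ ∙ EuclideanSpace.single (2 : Fin 3) (1 : ℝ)).reflection).trans L')).Adm G d)
    (hstd : StdFrame G) :
    (basalSystem ((basalSystem L').Fw κ₀)).Adm G d ∨
      (basalSystem (((ℝ ∙ EuclideanSpace.single (2 : Fin 3) (1 : ℝ)).reflection).trans ((basalSystem L').Fw κ₀))).Adm G d := by
  set S₁ : PlateSystem := basalSystem L' with hS₁
  have hr₀2 : r₀ 2 = 0 := (Finset.mem_filter.1 hr₀).2
  obtain ⟨hlet₀, hch₀⟩ := wfChain_letters hκ₀
  have hunit₀ : ∀ μ ∈ κ₀, ‖μ‖ = 1 := fun μ hμ => (hlet₀ μ hμ).1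
  -- the connecting chain `P` (prefix-closed) and the reduced word `P ++ κ₀`
  obtain ⟨P, -, hletP, hchP, himg, hpre⟩ := std_cases8_fw_prefix S₁ hunit₀ hstd₀ hstd
  have hchPκ₀ := isChain_append_of_minimal S₁ hκ₀ hmin hletP hchP hpre
  have hletPκ₀ := letters_append hletP hlet₀
  have hunitPκ₀ : ∀ μ ∈ P ++ κ₀, ‖μ‖ = 1 := fun μ hμ => (hletPκ₀ μ hμ).1
  rcases hadm with ⟨r, hr, κ, hκ, hG, hd⟩ | ⟨r, hr, κ, hκ, hG, hd⟩
  · -- a class of the first system: `κ ≃ Q ++ κ₀` letterwise up to sign, and the base moves to `F`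
    left
    obtain ⟨hlet, hch⟩ := wfChain_letters hκ
    have hunit : ∀ μ ∈ κ, ‖μ‖ = 1 := fun μ hμ => (hlet μ hμ).1
    rw [hG] at himg
    have hF2 := reduced_forall₂_of_foldl_image_eq κ (P ++ κ₀) hlet hletPκ₀ hch hchPκ₀
      (foldl_image_eq_of_image_fw_eq S₁ hunit hunitPκ₀ himg)
    have hdrop : List.Forall₂ (fun a b => a = b ∨ a = -b) (κ.drop P.length) κ₀ := List.forall₂_drop_append κ P κ₀ hF2
    have hFeq : S₁.Fw (κ.drop P.length) = S₁.Fw κ₀ :=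
      fw_eq_of_forall₂ S₁ hdrop (fun μ hμ => hunit μ (List.mem_of_mem_drop hμ)) hunit₀
    rw [← hFeq]
    refine adm_transfer_of_append L' hr (κ.take P.length) (κ.drop P.length) ?_ ?_ ?_
    · rw [List.take_append_drop]; exact hκ
    · rw [List.take_append_drop]; exact hG
    · rw [List.take_append_drop, hG]; exact hd
  · -- a class of the companion: its dozen reads `κ ++ [e₃]` in the first system, whose last letter cannot match `κ₀`'s
    have hr2 : r 2 = 0 := (Finset.mem_filter.1 hr).2
    obtain ⟨hlet, -⟩ := wfChain_letters hκ
    have hunit : ∀ μ ∈ κ, ‖μ‖ = 1 := fun μ hμ => (hlet μ hμ).1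
    obtain ⟨hlet', hch'⟩ := letters_chain_concat_axis hr2 hκ
    have hunit' : ∀ μ ∈ κ ++ [EuclideanSpace.single (2 : Fin 3) (1 : ℝ)], ‖μ‖ = 1 := fun μ hμ => (hlet' μ hμ).1
    have himg' : (S₁.Fw (κ ++ [EuclideanSpace.single (2 : Fin 3) (1 : ℝ)]) : EuclideanSpace ℝ (Fin 3) → EuclideanSpace ℝ (Fin 3)) ''
        ↑fccSlots = (S₁.Fw (P ++ κ₀) : EuclideanSpace ℝ (Fin 3) → EuclideanSpace ℝ (Fin 3)) '' ↑fccSlots := by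
      rw [← himg, hG, hS₁]
      exact (image_fw_halfTurn L' basalHexagon basalHexagon hunit).symm
    have hF2 := reduced_forall₂_of_foldl_image_eq _ _ hlet' hletPκ₀ hch' hchPκ₀
      (foldl_image_eq_of_image_fw_eq S₁ hunit' hunitPκ₀ himg')
    rcases List.eq_nil_or_concat' κ₀ with h0 | ⟨K, t, hK⟩
    · -- `κ₀ = []`: `F = L̃` and the class is a companion class verbatim
      subst h0
      right
      exact ⟨r, hr, κ, hκ, hG, hd⟩
    · exfalso
      have ht : t ∈ κ₀ := by rw [hK]; simp
      obtain ⟨h1, h2⟩ := wfChain_letter_ne_axis hr₀2 hκ₀ ht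
      rw [hK, ← List.append_assoc] at hF2
      rcases last_rel_of_forall₂_concat hF2 with h | h
      · exact h1 h.symm
      · exact h2 (by rw [h, neg_neg])

/-! ### One standard frame for all standard classes -/

/-- The half-turn about `e₃` is an involution: `H ≫ H ≫ L̃ = L̃`. -/
theorem halfTurn_trans_halfTurn_trans (L' : EuclideanSpace ℝ (Fin 3) ≃ₗᵢ[ℝ] EuclideanSpace ℝ (Fin 3)) :
    ((ℝ ∙ EuclideanSpace.single (2 : Fin 3) (1 : ℝ)).reflection).trans
        (((ℝ ∙ EuclideanSpace.single (2 : Fin 3) (1 : ℝ)).reflection).trans L') = L' :=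
  LinearIsometryEquiv.ext fun x => by
    simp only [LinearIsometryEquiv.trans_apply, Submodule.reflection_reflection]

open scoped Classical in
/-- **CLASS COLLAPSE ON THE EIGHT STANDARD DOZENS (transfer form).**  For every frame `L̃` there is a STANDARD frame `L₀` such that
every admissible class `(G, d)` of `basalSystem L̃` or `basalSystem (H ≫ L̃)` whose frame `G` is standard is an admissible class of
`basalSystem L₀` or `basalSystem (H ≫ L₀)` — the same frame, the same direction. -/
theorem exists_stdFrame_adm_transfer (L' : EuclideanSpace ℝ (Fin 3) ≃ₗᵢ[ℝ] EuclideanSpace ℝ (Fin 3)) :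
    ∃ L₀ : EuclideanSpace ℝ (Fin 3) ≃ₗᵢ[ℝ] EuclideanSpace ℝ (Fin 3), StdFrame L₀ ∧
      ∀ (G : EuclideanSpace ℝ (Fin 3) ≃ₗᵢ[ℝ] EuclideanSpace ℝ (Fin 3)) (d : EuclideanSpace ℝ (Fin 3)),
        ((basalSystem L').Adm G d ∨
          (basalSystem (((ℝ ∙ EuclideanSpace.single (2 : Fin 3) (1 : ℝ)).reflection).trans L')).Adm G d) →
        StdFrame G →
        ((basalSystem L₀).Adm G d ∨
          (basalSystem (((ℝ ∙ EuclideanSpace.single (2 : Fin 3) (1 : ℝ)).reflection).trans L₀)).Adm G d) := by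
  by_cases h₁ : ∃ k : ℕ, ∃ r ∈ basalHexagon, ∃ κ : List (EuclideanSpace ℝ (Fin 3)), κ.length = k ∧ WFChain r κ ∧
      StdFrame ((basalSystem L').Fw κ)
  · -- a minimal standard class of the first system
    obtain ⟨r₀, hr₀, κ₀, hlen, hκ₀, hstd₀⟩ := Nat.find_spec h₁
    have hmin : ∀ κ : List (EuclideanSpace ℝ (Fin 3)), WFChain r₀ κ → κ.length < κ₀.length →
        ¬ StdFrame ((basalSystem L').Fw κ) :=
      fun κ hκ hlt hstd => Nat.find_min h₁ (hlen ▸ hlt) ⟨r₀, hr₀, κ, rfl, hκ, hstd⟩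
    exact ⟨_, hstd₀, fun G d hadm hstd => adm_transfer_of_minimal L' hr₀ hκ₀ hstd₀ hmin hadm hstd⟩
  · by_cases h₂ : ∃ k : ℕ, ∃ r ∈ basalHexagon, ∃ κ : List (EuclideanSpace ℝ (Fin 3)), κ.length = k ∧ WFChain r κ ∧
        StdFrame ((basalSystem (((ℝ ∙ EuclideanSpace.single (2 : Fin 3) (1 : ℝ)).reflection).trans L')).Fw κ)
    · -- a minimal standard class of the companion: the same lemma with base `H ≫ L̃`, whose companion is `L̃`
      obtain ⟨r₀, hr₀, κ₀, hlen, hκ₀, hstd₀⟩ := Nat.find_spec h₂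
      have hmin : ∀ κ : List (EuclideanSpace ℝ (Fin 3)), WFChain r₀ κ → κ.length < κ₀.length →
          ¬ StdFrame ((basalSystem (((ℝ ∙ EuclideanSpace.single (2 : Fin 3) (1 : ℝ)).reflection).trans L')).Fw κ) :=
        fun κ hκ hlt hstd => Nat.find_min h₂ (hlen ▸ hlt) ⟨r₀, hr₀, κ, rfl, hκ, hstd⟩
      refine ⟨_, hstd₀, fun G d hadm hstd => ?_⟩
      have hadm' : (basalSystem (((ℝ ∙ EuclideanSpace.single (2 : Fin 3) (1 : ℝ)).reflection).trans L')).Adm G d ∨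
          (basalSystem (((ℝ ∙ EuclideanSpace.single (2 : Fin 3) (1 : ℝ)).reflection).trans
            (((ℝ ∙ EuclideanSpace.single (2 : Fin 3) (1 : ℝ)).reflection).trans L'))).Adm G d := by
        rw [halfTurn_trans_halfTurn_trans]; exact hadm.symm
      exact adm_transfer_of_minimal _ hr₀ hκ₀ hstd₀ hmin hadm' hstd
    · -- no standard class at all: vacuous
      refine ⟨LinearIsometryEquiv.refl ℝ _, Or.inl (by simp), fun G d hadm hstd => ?_⟩
      exfalso
      rcases hadm with ⟨r, hr, κ, hκ, hG, hd⟩ | ⟨r, hr, κ, hκ, hG, hd⟩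
      · exact h₁ ⟨κ.length, r, hr, κ, rfl, hκ, hG ▸ hstd⟩
      · exact h₂ ⟨κ.length, r, hr, κ, rfl, hκ, hG ▸ hstd⟩

end Collapse8

end Summit.Ventures.Crystal3D.Theorems

end
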